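import Summits.HodgeConjecture.HodgeConjecture.Theorems.F0P2oU1DichotomyTransport
import Literature.NumberTheory.GelbartRogawski1991.ThetaTypeNonsplitJacquetModule
import HarnessLib

/-!
# Crux `H413`, row #106 (N4 ∕ T3b) road of B-p14 (g28), step (ii): MULTIPLICITY ONE FOR GR's `ω¹(γ_v, ψ_v)` IN CM CURRENCY —
# `dim ℱ_v[ψ] ≤ 1` for `ℱ_v = lineWeilCM … μ hμ ε v`, hence `dim r_N(X_v) ≤ 1` from the N3 letter

Cell `hodgecm-mathlib` (D-0151), FLOOR 0, crux item H413 = `stmt-HodgeConjecture-24833`; THEOREMS ONLY (kernel lane,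
`--supports stmt-HodgeConjecture-24833 --as helper`; no `def`, no instance, no notation, no named fact, no `sorry`).  Seat B-p10 (g22).
HC_CM is proved only modulo the 2 remaining named inputs (hLiu418, h413) — behind them the booked printed statements + the MOD package —
until rung 0 closes; nothing here discharges any of them.

WHY.  B-p14 (g28)'s in-house road for the booked letter #106 `Rogawski1990.KeysCaseTwoReducible` (cell bus 2026-08-31T20:35:02Z) compares
two Jacquet-module dimensions along the Borel of `U(Φ₃)(L⁺_v)` at a non-split `v`: `dim r_N(i_G(χθ)) = 2` (★ N1, `U3PrincipalSeriesJacquetFiltration_holds`)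
against `dim r_N(X_v) ≤ 1` for Liu's local theta type `X_v(μ, ε, χ_f)`.  The N3 letter ★ `GelbartRogawski1991.thetaType_nonsplit_jacquetModule` (a)
identifies `r_N(X_v)` with the `ψθ`-weight space `ℱ_v[ψθ]` of GR's rank-one oscillator representation `ω¹(γ_v, ψ_v)` = ★ `lineWeilCM … μ hμ ε v`
(the body of ★ `OccursInLineWeilCM`); the bound `dim ℱ_v[ψ] ≤ 1` is MVW's multiplicity one for the `(U(1), U(1))` oscillator representation,
★ `finiteDimensional_weightSpace_rankOne` [MoeglinVignerasWaldspurger1987, Chap. 3 §IV.4 Théorème principal 1) a)] — but that theorem lives on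
the δ-MODEL carrier `(MpPsi.toRep (localSchrodinger F 1 T_V v)).comp s₁` over `U(J_V)(F_v)`, not on `lineWeilCM`'s `(lineSplittingsCM …).omegaLoc v ∘ localCenter`
over `U((ε))(L⁺_v)`.  This file crosses that bridge once, by the dictionary ★ `weightSpace_omegaLoc_localCenter_eq` of
`Theorems/F0P2oU1DichotomyTransport.lean` (the `e′_a`-transported section ★ `lineTransportSection`), exactly as ★ `F0P2oU1DichotomyOfDisjoint.hDich_of_disjoint`
does for the `dim + dim = 1` sum.

WHAT IS PROVED (at a place `v` of `L⁺` NON-SPLIT in `L`, every line data `(e₀, dL)`, conjugate-symplectic `μ`, line class `ε`):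
* `finrank_weightSpace_lineWeilCM_le_one` — for every CONTINUOUS character `ψ` of `E¹_v`, the `ψ ∘ det`-weight space of `lineWeilCM L e₀ dL hdL hdL0 μ hμ ε v`
  (the body of ★ `OccursInLineWeilCM … ε v ψ` VERBATIM) is finite-dimensional of dimension `≤ 1`;
* `finrank_coinvariants_xThetaGqsCM_le_one` — hence, under the N3 letter (hypothesis `hN3`, binders = N3's VERBATIM), the Jacquet module
  `r_N(X_v)` of `X_v(μ, ε, χ_f)` read on `U(Φ₃)(L⁺_v)` (★ `xThetaGqsCM`, `N`-coinvariants of ★ `ParabolicTriple.restrict` along ★ `cmBorelTriple L 3 v`)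
  is finite-dimensional of dimension `≤ 1`.
ROAD.  (a) `n₀ = 1`, `e₀ = Equiv.prodUnique (Fin 1) (Fin 1)` (the only reindexing); (b) `L_w` is a field at a non-split `v` (★ `LocalRing.isField_of_smul_eq`);
(c) dictionary ★ `weightSpace_omegaLoc_localCenter_eq` at `𝓢 := lineSplittingsCM … ε` (a ★ `FinLocalSplittings` family of the pair model
`(realDiagonal dL, imagUnit L)` twisted by the line `ε`); (d) on the compact torus `U((dL))(L⁺_v)` (★ `compactSpace_localPi_rankOne`) the character
`ψ ∘ det ∘ localPiEquiv` is continuous (★ `continuous_localDet_localPiEquiv`) hence unitary, and ★ `finiteDimensional_weightSpace_rankOne` applies at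
the transported section (★ `proj_lineTransportSection`, ★ `isSmooth_lineTransportSection`).

## References
* [MoeglinVignerasWaldspurger1987] C. Mœglin, M.-F. Vignéras, J.-L. Waldspurger, LNM 1291 (1987): Chap. 3 §IV.4 Théorème principal 1) a); Chap. 2 II.1.
* [GelbartRogawski1991] S. Gelbart, J. Rogawski, Invent. Math. 105 (1991): §3.2 (3.2.1)–(3.2.3) p. 457; Remark p. 466; §5.2 p. 467 L8–11.
* [HarrisKudlaSweet1996] M. Harris, S. Kudla, W. Sweet, JAMS 9 (1996): Cor. 4.4 p. 962 (m = n = 1).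
* [Kudla1986] S. Kudla, Invent. Math. 83 (1986): Thm. 2.8.
-/

set_option autoImplicit false
-- the mandated namespace has the single-problem summit's repeated segment (`HodgeConjecture.HodgeConjecture`)
set_option linter.dupNamespace false

noncomputable section

open NumberField IsDedekindDomain MeasureTheory
open scoped Matrix Kronecker

open Literature.NumberTheory Literature.NumberTheory.Automorphic Literature.NumberTheory.Automorphic.UnitaryGroup
open Literature.NumberTheory.Automorphic.IdeleClassGroup
open Literature.NumberTheory.Automorphic.Liu2021 Literature.NumberTheory.Automorphic.Liu2021.Def411WeilCarriers
open Literature.NumberTheory.Rogawski1990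
open Literature.NumberTheory.GelbartRogawski1991 Literature.NumberTheory.GelbartRogawski1991.UnitaryDualPair
open Literature.NumberTheory.GelbartRogawski1991.UnitaryDualPair.LocalSplitting
open Literature.RepresentationTheory Literature.RepresentationTheory.HeisenbergGroup
open Literature.RepresentationTheory.MoeglinVignerasWaldspurger1987

namespace Summit.HodgeConjecture.HodgeConjecture.Cruxes.H413.F0P2oLineWeilCMMultiplicityOne

open Summit.HodgeConjecture.HodgeConjecture.Cruxes.H413.F0P2oU1DichotomyTransport

section CM

open Literature.RepresentationTheory.Liu2021

/-- The values of a character of a compact group in `ℂˣ` whose underlying complex-valued function is continuous have norm `1`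
(the image of `‖χ‖` is a bounded subgroup of `ℝ_{>0}`; proof as ★ `F0P2oThetaCenterCharGlobalise.norm_apply_eq_one_of_compactSpace`, restated
for the coercion-continuity hypothesis to keep the import cone small). [folklore] -/
theorem norm_apply_eq_one_of_compactSpace_of_continuous_coe {Γ : Type*} [Group Γ] [TopologicalSpace Γ] [CompactSpace Γ] (χ : Γ →* ℂˣ)
    (hχ : Continuous fun g => ((χ g : ℂˣ) : ℂ)) (g : Γ) : ‖((χ g : ℂˣ) : ℂ)‖ = 1 := by
  have hc : Continuous fun τ : Γ => ‖((χ τ : ℂˣ) : ℂ)‖ := continuous_norm.comp hχ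
  obtain ⟨M, hM⟩ := (isCompact_range hc).isBounded.bddAbove
  have hle : ∀ τ : Γ, ‖((χ τ : ℂˣ) : ℂ)‖ ≤ 1 := fun τ => not_lt.mp fun hlt => by
    obtain ⟨m, hm⟩ := pow_unbounded_of_one_lt M hlt
    have hm' : ‖((χ τ : ℂˣ) : ℂ)‖ ^ m ≤ M := by
      have := hM (Set.mem_range_self (τ ^ m))
      simpa only [map_pow, Units.val_pow_eq_pow_val, norm_pow] using this
    exact absurd hm' (not_le.mpr hm)
  refine le_antisymm (hle g) ?_
  have h1 := hle g⁻¹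
  rw [map_inv, Units.val_inv_eq_inv_val, norm_inv] at h1
  exact (inv_le_one₀ (norm_pos_iff.mpr (Units.ne_zero _))).mp h1

set_option synthInstance.maxHeartbeats 400000 in
set_option maxHeartbeats 8000000 in -- MEASURED (as ★ `F0P2oU1DichotomyOfDisjoint`): the CM abbreviations `lineSplittingsCM` ∕ `lineWeilCM` are heavy to elaborate
/-- **MULTIPLICITY ONE FOR `ω¹(γ_v, ψ_v)` IN CM CURRENCY.**  At a place `v` of `L⁺` non-split in `L`, for every continuous character `ψ` of
`E¹_v`, the `ψ ∘ det`-weight space of GR's rank-one oscillator representation `lineWeilCM L e₀ dL hdL hdL0 μ hμ ε v` (the body of ★ `OccursInLineWeilCM`)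
is finite-dimensional of dimension `≤ 1` — MVW's «`dim Hom_{U(1)}(ω, ξ) ≤ 1`» transported from the δ-model (★ `finiteDimensional_weightSpace_rankOne`)
along the dictionary ★ `weightSpace_omegaLoc_localCenter_eq`.
[cite: MoeglinVignerasWaldspurger1987, Chap. 3 §IV.4 Théorème principal 1) a); Chap. 2 II.1] [cite: GelbartRogawski1991, Remark p. 466; §5.2 p. 467 L8–11] -/
theorem finrank_weightSpace_lineWeilCM_le_one (L : Type) [Field L] [NumberField L] [IsCMField L]
    {n₀ : ℕ} (e₀ : Fin 1 × Fin 1 ≃ Fin n₀) (dL : Fin 1 → L) (hdL : ∀ i, IsCMField.complexConj L (dL i) = dL i) (hdL0 : ∀ i, dL i ≠ 0)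
    (μ : Literature.NumberTheory.Automorphic.IdeleClassGroup L →ₜ* Circle) (hμ : IsConjugateSymplectic L μ)
    (ε : (↥(maximalRealSubfield L))ˣ) (v : HeightOneSpectrum (𝓞 ↥(maximalRealSubfield L)))
    (hv : ∀ w : PlacesOver L v, IsCMField.complexConj L • w.1 = w.1)
    (ψ : ↥(normOneUnits (conjLocal L (IsCMField.complexConj L) v)) →* ℂˣ) (hψ : Continuous fun β => ((ψ β : ℂˣ) : ℂ)) :
    FiniteDimensional ℂ ↥(weightSpace (lineWeilCM L e₀ dL hdL hdL0 μ hμ ε v) id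
        (fun u => ((ψ (localDet (IsCMField.complexConj L) v
          (isUnit_iff_ne_zero.mpr (by rw [Matrix.det_fin_one]; exact JW_apply_ne_zero (↥(maximalRealSubfield L)) L ε))
          (localPiEquiv L (IsCMField.complexConj L) 1 (JW (↥(maximalRealSubfield L)) L ε) v u)) : ℂˣ) : ℂ))) ∧
      Module.finrank ℂ ↥(weightSpace (lineWeilCM L e₀ dL hdL hdL0 μ hμ ε v) id
        (fun u => ((ψ (localDet (IsCMField.complexConj L) v
          (isUnit_iff_ne_zero.mpr (by rw [Matrix.det_fin_one]; exact JW_apply_ne_zero (↥(maximalRealSubfield L)) L ε))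
          (localPiEquiv L (IsCMField.complexConj L) 1 (JW (↥(maximalRealSubfield L)) L ε) v u)) : ℂˣ) : ℂ))) ≤ 1 := by
  -- (a) the only reindexing: `n₀ = 1`, `e₀ = Equiv.prodUnique`
  obtain rfl : n₀ = 1 := by simpa using (Fintype.card_congr e₀).symm
  obtain rfl : e₀ = Equiv.prodUnique (Fin 1) (Fin 1) := Equiv.ext fun _ => Subsingleton.elim _ _
  -- (b) the setting at `v`: `L_w` is a field; `J_V = (dL)` is a unit line
  obtain ⟨w⟩ := (inferInstance : Nonempty (PlacesOver L v))
  have hE : IsField (UnitaryGroup.LocalRing L v) :=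
    LocalRing.isField_of_smul_eq (IsCMField.complexConj L) (IsCMField.complexConj_ne_one L) w (hv w)
  have hJV0 : Matrix.diagonal dL 0 0 ≠ 0 := by rw [Matrix.diagonal_apply_eq]; exact hdL0 0
  have hJVd : IsUnit (Matrix.diagonal dL).det := isUnit_iff_ne_zero.2 (by rw [Matrix.det_fin_one]; exact hJV0)
  -- (c) the dictionary: letter side ↔ the `e′_ε`-transported δ-model side
  rw [weightSpace_omegaLoc_localCenter_eq (↥(maximalRealSubfield L)) L (IsCMField.complexConj L) (complexConj_imagUnit L) (imagUnit_ne_zero L)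
    (imagUnit_mul_self L) (realDiagonal L dL hdL) (realDiagonal_isSymm L dL hdL) (Matrix.diagonal dL) (realDiagonal_map L dL hdL).symm v ε
    (lineSplittingsCM L (Equiv.prodUnique (Fin 1) (Fin 1)) dL hdL hdL0 (toHeckeCharacter L μ) ((isOscillatorChar_toHeckeCharacter_iff μ).mpr hμ) ε)
    hJVd hJV0 _ ψ]
  -- (d) the pulled-back character `ξ = ψ ∘ det ∘ localPiEquiv` on the compact torus `U((dL))(L⁺_v)`: continuous, hence unitary
  haveI : CompactSpace ↥(localPi L (IsCMField.complexConj L) 1 (Matrix.diagonal dL) v) :=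
    compactSpace_localPi_rankOne (↥(maximalRealSubfield L)) L (IsCMField.complexConj L) (complexConj_imagUnit L) (imagUnit_ne_zero L)
      (isUnit_det_realDiagonal L dL hdL hdL0) (realDiagonal_map L dL hdL).symm v hE
  obtain ⟨ξ, hξ⟩ : ∃ f : ↥(localPi L (IsCMField.complexConj L) 1 (Matrix.diagonal dL) v) →* ℂˣ,
      ∀ k, f k = ψ (localDet (IsCMField.complexConj L) v hJVd (localPiEquiv L (IsCMField.complexConj L) 1 (Matrix.diagonal dL) v k)) :=
    ⟨ψ.comp ((localDet (IsCMField.complexConj L) v hJVd).comp (localPiEquiv L (IsCMField.complexConj L) 1 (Matrix.diagonal dL) v).toMonoidHom),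
      fun _ => rfl⟩
  have hfun : (fun k => ((ψ (localDet (IsCMField.complexConj L) v hJVd (localPiEquiv L (IsCMField.complexConj L) 1 (Matrix.diagonal dL) v k)) : ℂˣ) : ℂ)) =
      fun k => ((ξ k : ℂˣ) : ℂ) := funext fun k => by rw [hξ]
  have hξc : Continuous fun k => ((ξ k : ℂˣ) : ℂ) := by
    rw [← hfun]
    exact hψ.comp (continuous_localDet_localPiEquiv L (IsCMField.complexConj L) v (Matrix.diagonal dL) hJVd)
  have hξu : ∀ k, ‖((ξ k : ℂˣ) : ℂ)‖ = 1 := norm_apply_eq_one_of_compactSpace_of_continuous_coe ξ hξc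
  rw [hfun]
  -- (e) MVW's multiplicity one at the transported section
  exact finiteDimensional_weightSpace_rankOne (↥(maximalRealSubfield L)) L (IsCMField.complexConj L)
    (conj_lineDelta (complexConj_imagUnit L) ε) (lineDelta_ne_zero (imagUnit_ne_zero L) ε) (lineDelta_mul_self (imagUnit_mul_self L) ε)
    (realDiagonal_isSymm L dL hdL) (isUnit_det_realDiagonal L dL hdL hdL0) (realDiagonal_map L dL hdL).symm v hE
    (lineTransportSection (↥(maximalRealSubfield L)) L (IsCMField.complexConj L) 1 (complexConj_imagUnit L) (imagUnit_ne_zero L) (imagUnit_mul_self L)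
      (realDiagonal L dL hdL) (realDiagonal_isSymm L dL hdL) (Matrix.diagonal dL) (realDiagonal_map L dL hdL).symm ε v
      ((lineSplittingsCM L (Equiv.prodUnique (Fin 1) (Fin 1)) dL hdL hdL0 (toHeckeCharacter L μ) ((isOscillatorChar_toHeckeCharacter_iff μ).mpr hμ) ε).s v)
      ((lineSplittingsCM L (Equiv.prodUnique (Fin 1) (Fin 1)) dL hdL hdL0 (toHeckeCharacter L μ) ((isOscillatorChar_toHeckeCharacter_iff μ).mpr hμ) ε).proj_s v))
    (proj_lineTransportSection (↥(maximalRealSubfield L)) L (IsCMField.complexConj L) 1 (complexConj_imagUnit L) (imagUnit_ne_zero L) (imagUnit_mul_self L)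
      (realDiagonal L dL hdL) (realDiagonal_isSymm L dL hdL) (Matrix.diagonal dL) (realDiagonal_map L dL hdL).symm ε v
      ((lineSplittingsCM L (Equiv.prodUnique (Fin 1) (Fin 1)) dL hdL hdL0 (toHeckeCharacter L μ) ((isOscillatorChar_toHeckeCharacter_iff μ).mpr hμ) ε).s v)
      ((lineSplittingsCM L (Equiv.prodUnique (Fin 1) (Fin 1)) dL hdL hdL0 (toHeckeCharacter L μ) ((isOscillatorChar_toHeckeCharacter_iff μ).mpr hμ) ε).proj_s v))
    (isSmooth_lineTransportSection (↥(maximalRealSubfield L)) L (IsCMField.complexConj L) 1 (complexConj_imagUnit L) (imagUnit_ne_zero L) (imagUnit_mul_self L)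
      (realDiagonal L dL hdL) (realDiagonal_isSymm L dL hdL) (Matrix.diagonal dL) (realDiagonal_map L dL hdL).symm ε v
      ((lineSplittingsCM L (Equiv.prodUnique (Fin 1) (Fin 1)) dL hdL hdL0 (toHeckeCharacter L μ) ((isOscillatorChar_toHeckeCharacter_iff μ).mpr hμ) ε).s v)
      ((lineSplittingsCM L (Equiv.prodUnique (Fin 1) (Fin 1)) dL hdL hdL0 (toHeckeCharacter L μ) ((isOscillatorChar_toHeckeCharacter_iff μ).mpr hμ) ε).proj_s v)
      ((lineSplittingsCM L (Equiv.prodUnique (Fin 1) (Fin 1)) dL hdL hdL0 (toHeckeCharacter L μ) ((isOscillatorChar_toHeckeCharacter_iff μ).mpr hμ) ε).smooth v))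
    ξ hξu hξc

set_option synthInstance.maxHeartbeats 400000 in
set_option maxHeartbeats 8000000 in -- MEASURED (as ★ `ThetaTypeNonsplitJacquetModule`): the N3 letter's statement is heavy to elaborate
/-- **`dim r_N(X_v) ≤ 1` FROM THE N3 LETTER.**  Under ★ `GelbartRogawski1991.thetaType_nonsplit_jacquetModule` (hypothesis `hN3`; binders = the
letter's, VERBATIM): for every CM frame `(e₁, dV)`, reindexing `e₀`, conjugate-symplectic `μ`, continuous unitary `χ_f`, NON-SPLIT `v`, line class `ε`,
centre character `ψθ` with ★ `IsThetaCenterChar L μ χf ε v ψθ`, and form congruence `ᵗT̄ · (diag dV)_v · T = a · Φ₃`, the Jacquet module of Liu's local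
theta type `X_v(μ, ε, χ_f)` read on `U(Φ₃)(L⁺_v)` (★ `xThetaGqsCM`) along the Borel ★ `cmBorelTriple L 3 v` is finite-dimensional of dimension `≤ 1`:
N3 (a) `r_N(X_v) ≃ₗ ℱ_v[ψθ]` and `finrank_weightSpace_lineWeilCM_le_one` (`ψθ` is continuous by ★ `F0P2oK1occ.continuous_of_isThetaCenterChar`).
[cite: GelbartRogawski1991, §3.2 (3.2.1)–(3.2.3) p. 457] [cite: Kudla1986, Thm. 2.8] [cite: MoeglinVignerasWaldspurger1987, Chap. 3 §IV.4 Théorème principal 1) a)] -/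
theorem finrank_coinvariants_xThetaGqsCM_le_one
    (hN3 : Literature.NumberTheory.GelbartRogawski1991.thetaType_nonsplit_jacquetModule)
    (L : Type) [Field L] [NumberField L] [IsCMField L]
    {n' : ℕ} (e₁ : Fin 3 × Fin 1 ≃ Fin n') (dV : Fin 3 → L) (hdV : ∀ i, IsCMField.complexConj L (dV i) = dV i) (hdV0 : ∀ i, dV i ≠ 0)
    {n₀ : ℕ} (e₀ : Fin 1 × Fin 1 ≃ Fin n₀)
    (μ : Literature.NumberTheory.Automorphic.IdeleClassGroup L →ₜ* Circle) (hμ : IsConjugateSymplectic L μ)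
    (χf : UnitaryGroup.finAdelicOne (↥(maximalRealSubfield L)) L (IsCMField.complexConj L) →* ℂˣ)
    (hχc : Continuous χf) (hχu : ∀ z, ‖((χf z : ℂˣ) : ℂ)‖ = 1)
    (v : HeightOneSpectrum (𝓞 ↥(maximalRealSubfield L)))
    (hv : ∀ w : PlacesOver L v, IsCMField.complexConj L • w.1 = w.1)
    (ε : (↥(maximalRealSubfield L))ˣ) (ψθ : ↥(normOneUnits (conjLocal L (IsCMField.complexConj L) v)) →* ℂˣ)
    (hψθ : IsThetaCenterChar L μ χf ε v ψθ)
    (T : GL (Fin 3) (UnitaryGroup.LocalRing L v)) (a : UnitaryGroup.LocalRing L v) (ha : IsUnit a)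
    (h : formCongr (conjLocal L (IsCMField.complexConj L) v) T ((Matrix.diagonal dV).map (algebraMap L (UnitaryGroup.LocalRing L v))) =
      a • (Matrix.of fun i j : Fin 3 => if i.val + j.val + 1 = 3 then (1 : L) else 0).map (algebraMap L (UnitaryGroup.LocalRing L v))) :
    FiniteDimensional ℂ ((cmBorelTriple L 3 v).restrict (xThetaGqsCM L e₁ dV hdV hdV0 μ hμ χf ε v T ha h)).Coinvariants ∧
      Module.finrank ℂ ((cmBorelTriple L 3 v).restrict (xThetaGqsCM L e₁ dV hdV hdV0 μ hμ χf ε v T ha h)).Coinvariants ≤ 1 := by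
  obtain ⟨⟨e⟩, -⟩ := hN3 L e₁ dV hdV hdV0 e₀ μ hμ χf hχc hχu v hv ε ψθ hψθ T a ha h
  obtain ⟨hfd, hle⟩ := finrank_weightSpace_lineWeilCM_le_one L e₀ (kernelLineCM dV) (complexConj_kernelLineCM dV hdV)
    (kernelLineCM_ne_zero dV hdV0) μ hμ ε v hv ψθ (F0P2oK1occ.continuous_of_isThetaCenterChar L μ χf hχc ε v ψθ hψθ)
  haveI := hfd
  exact ⟨Module.Finite.equiv e.symm, e.finrank_eq ▸ hle⟩

end CM

end Summit.HodgeConjecture.HodgeConjecture.Cruxes.H413.F0P2oLineWeilCMMultiplicityOne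

end
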